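import Summits.ValiantsHypothesis.ValiantsHypothesis.Theorems.MonotoneRestorationOrbitCompressionQPOrbitSupport
import HarnessLib

/-!
# Route MonotoneRestoration — aside `OrbitCompressionQP` (stmt-ValiantsHypothesis-18332): from EVEN
# supports to SUPPORTS — reduced circuits

`OrbitSupport.evenSupport_of_orbitSize_lt_choose` (Dixon–Mortimer) gives every gate of a square-symmetric
circuit of small orbit size a set `X` such that every EVEN permutation fixing `X` pointwise extends to an
automorphism fixing the gate.  For REDUCED circuits (no two gates with the same label and children —
Dawar–Wilsenach's rigid normal form, `LabelledArithCircuit.IsReduced`) the alternating group upgrades to the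
symmetric group by the circuit-structural induction of Dawar–Wilsenach (ToCL 2022, Thm 4.10; quoted in
Dawar–Pago–Seppelt 2025, proof of Lemma 4.3):

* `support_of_evenSupport_reduced` — **in a reduced `Sym_n`-symmetric circuit in which every gate has an
  even support of size `≤ s`, `2s + 4 ≤ n`, every gate has a SUPPORT of size `≤ s`**: every permutation
  fixing it pointwise extends to an automorphism fixing the gate (and hence fixes its value,
  `support_eval_reduced`).  Induction along the wires: a transposition `(a b)` outside the support acts on
  each child `h` like the even permutation `(a b)(c c')` with `c, c'` outside the support of `h`; so it
  permutes the children, preserves the label, and reducedness forces it to fix the gate; input gates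
  `x_ij` have `i, j` in their even support (3-cycles).
* `exists_reduced_symmetric_of_valueDerivation` — the value-orbit symmetrisation theorem of crux 18293
  (`ValueDerivation.exists_symmetric_of_valueDerivation`) produces a REDUCED circuit (its term circuit is
  reduced, `TermCircuit.circuit_isReduced`) — recorded with `IsReduced` in the conclusion, so that every
  quasi-polynomial-orbit symmetric circuit can be replaced by a reduced one (`exists_reduced_of_qpOrbit`).

Helper file (`--supports stmt-ValiantsHypothesis-18332`); def-free; nothing here is a named fact.
-/

noncomputable section

open scoped Classical

-- `Summit.ValiantsHypothesis.ValiantsHypothesis.…` is the tree's single-conjunct layout (Sub = Summit).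
set_option linter.dupNamespace false

namespace Summit.ValiantsHypothesis.ValiantsHypothesis.Theorems

namespace OrbitSupport

open Literature.Computability.AlgebraicComplexity MvPolynomial HTerm

universe u v w

/-! ### Two free points -/

/-- Outside a set of `≤ s` indices and two further sets of sizes `≤ s` and `≤ 2` there are two distinct
indices, provided `2s + 4 ≤ n`. [folklore] -/
theorem exists_two_outside {n s : ℕ} (hn : 2 * s + 4 ≤ n) (A B D : Finset (Fin n)) (hA : A.card ≤ s)
    (hB : B.card ≤ s) (hD : D.card ≤ 2) :
    ∃ c c' : Fin n, c ≠ c' ∧ c ∉ A ∧ c ∉ B ∧ c ∉ D ∧ c' ∉ A ∧ c' ∉ B ∧ c' ∉ D := by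
  have hcard : 2 ≤ (Finset.univ \ (A ∪ B ∪ D)).card := by
    rw [Finset.card_univ_sdiff, Fintype.card_fin]
    have := (Finset.card_union_le (A ∪ B) D).trans (Nat.add_le_add_right (Finset.card_union_le A B) _)
    omega
  obtain ⟨c, hc, c', hc', hcc'⟩ := Finset.one_lt_card.1 hcard
  simp only [Finset.mem_sdiff, Finset.mem_univ, Finset.mem_union, not_or, true_and] at hc hc'
  exact ⟨c, c', hcc', hc.1.1, hc.1.2, hc.2, hc'.1.1, hc'.1.2, hc'.2⟩

/-! ### Even supports are supports in reduced circuits -/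

/-- **FROM EVEN SUPPORTS TO SUPPORTS IN REDUCED CIRCUITS** (Dawar–Wilsenach's induction).  Let `C` be a
reduced `Sym_n`-symmetric labelled circuit on the `n × n` variable matrix in which every gate `g` has a set
`X g` of at most `s` indices such that every even permutation fixing `X g` pointwise extends to an
automorphism fixing `g`, and let `2s + 4 ≤ n`.  Then every permutation fixing `X g` pointwise extends to an
automorphism fixing `g`. [cite: DawarWilsenach2021, §4 (Thm 4.10); DawarPagoSeppelt2025, §4 (proof of Lemma 4.3)] -/
theorem support_of_evenSupport_reduced {n : ℕ} {K : Type u} {Y : Type*} {G : Type w}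
    [MulAction (Equiv.Perm (Fin n)) Y] (C : LabelledArithCircuit K (Fin n × Fin n) Y G)
    (hR : C.IsReduced) (hC : C.IsSymmetric (Equiv.Perm (Fin n))) {s : ℕ} (hn : 2 * s + 4 ≤ n)
    (X : G → Finset (Fin n)) (hXcard : ∀ g, (X g).card ≤ s)
    (hX : ∀ g (ρ : Equiv.Perm (Fin n)), (∀ x ∈ X g, ρ x = x) → Equiv.Perm.sign ρ = 1 →
      ∃ π : Equiv.Perm G, C.IsAutomorphismExtending ρ π ∧ π g = g) :
    ∀ g (ρ : Equiv.Perm (Fin n)), (∀ x ∈ X g, ρ x = x) →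
      ∃ π : Equiv.Perm G, C.IsAutomorphismExtending ρ π ∧ π g = g := by
  -- the designed automorphisms (unique by reducedness) form an action
  choose π hπ using hC
  have hrigid : C.IsRigid (Equiv.Perm (Fin n)) := hR.isRigid
  have hπmul : ∀ a b : Equiv.Perm (Fin n), π (a * b) = π a * π b := fun a b =>
    hrigid _ _ _ (hπ (a * b)) ((hπ b).trans (hπ a))
  have hfix_of : ∀ g (ρ : Equiv.Perm (Fin n)), (∃ π' : Equiv.Perm G,
      C.IsAutomorphismExtending ρ π' ∧ π' g = g) → π ρ g = g := by
    rintro g ρ ⟨π', hπ', hg⟩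
    rw [hrigid _ _ _ (hπ ρ) hπ']; exact hg
  -- it suffices to treat the designed automorphisms
  suffices key : ∀ g (ρ : Equiv.Perm (Fin n)), (∀ x ∈ X g, ρ x = x) → π ρ g = g from
    fun g ρ hρ => ⟨π ρ, hπ ρ, key g ρ hρ⟩
  intro g
  induction g using C.wf.induction with
  | h g ih =>
    -- Step 1: every TRANSPOSITION outside `X g` fixes `g`
    have htrans : ∀ a b : Fin n, a ≠ b → a ∉ X g → b ∉ X g → π (Equiv.swap a b) g = g := by
      intro a b hab haX hbX
      rcases hl : C.label g with x | c | _ | _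
      · -- input gate `x_ij`: both indices lie in `X g` (3-cycles), so the swap fixes the label
        have hin : ∀ i : Fin n, (i = x.1 ∨ i = x.2) → i ∈ X g := by
          intro i hi
          by_contra hiX
          obtain ⟨c, c', hcc', hcA, -, hcD, hc'A, -, hc'D⟩ :=
            exists_two_outside hn (X g) ∅ {i} (hXcard g) (by simp) (by simp)
          have hci : c ≠ i := fun h => hcD (by simp [h])
          have hc'i : c' ≠ i := fun h => hc'D (by simp [h])
          set σ : Equiv.Perm (Fin n) := Equiv.swap i c * Equiv.swap c c' with hσ
          have hσX : ∀ y ∈ X g, σ y = y := by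
            intro y hy
            have hyi : y ≠ i := ne_of_mem_of_not_mem hy hiX
            have hyc : y ≠ c := ne_of_mem_of_not_mem hy hcA
            have hyc' : y ≠ c' := ne_of_mem_of_not_mem hy hc'A
            rw [hσ, Equiv.Perm.mul_apply, Equiv.swap_apply_of_ne_of_ne hyc hyc',
              Equiv.swap_apply_of_ne_of_ne hyi hyc]
          have hσsign : Equiv.Perm.sign σ = 1 := by
            rw [hσ, map_mul, Equiv.Perm.sign_swap hci.symm, Equiv.Perm.sign_swap hcc',
              Int.units_mul_self]
          have hσg : π σ g = g := hfix_of g σ (hX g σ hσX hσsign)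
          have hlab := (hπ σ).label_apply g
          rw [hσg, hl, CircuitLabel.smul_var] at hlab
          have hσx : σ • x = x := by injection hlab.symm
          have hσi : σ i = c := by
            rw [hσ, Equiv.Perm.mul_apply, Equiv.swap_apply_of_ne_of_ne hci.symm hc'i.symm,
              Equiv.swap_apply_left]
          rcases hi with rfl | rfl
          · exact hci ((congrArg Prod.fst hσx).symm.trans hσi).symm
          · exact hci ((congrArg Prod.snd hσx).symm.trans hσi).symm
        have h1 : Equiv.swap a b x.1 = x.1 := Equiv.swap_apply_of_ne_of_ne
          (ne_of_mem_of_not_mem (hin x.1 (Or.inl rfl)) haX) (ne_of_mem_of_not_mem (hin x.1 (Or.inl rfl)) hbX)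
        have h2 : Equiv.swap a b x.2 = x.2 := Equiv.swap_apply_of_ne_of_ne
          (ne_of_mem_of_not_mem (hin x.2 (Or.inr rfl)) haX) (ne_of_mem_of_not_mem (hin x.2 (Or.inr rfl)) hbX)
        refine C.eq_of_label_eq _ _ (by rw [(hπ _).label_apply, hl]; simp) ?_
        rw [(hπ _).label_apply, hl, CircuitLabel.smul_var]
        change CircuitLabel.var (Equiv.swap a b x.1, Equiv.swap a b x.2) = CircuitLabel.var x
        rw [h1, h2]
      · -- constant gate: fixed by every automorphism
        exact (hπ _).apply_eq_self_of_label_const hl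
      · -- addition gate: the swap permutes the children
        refine hR _ _ (by rw [(hπ _).label_apply, hl]; rfl) ?_
        refine Finset.eq_of_subset_of_card_le (fun k hk => ?_) (by rw [(hπ _).children_apply,
          Finset.card_map])
        rw [(hπ _).children_apply, Finset.mem_map] at hk
        obtain ⟨h, hh, rfl⟩ := hk
        obtain ⟨c, c', hcc', hcg, hch, hcD, hc'g, hc'h, hc'D⟩ :=
          exists_two_outside hn (X g) (X h) {a, b} (hXcard g) (hXcard h) Finset.card_le_two
        have hfixh : π (Equiv.swap c c') h = h :=
          ih h hh _ fun y hy => Equiv.swap_apply_of_ne_of_ne (ne_of_mem_of_not_mem hy hch)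
            (ne_of_mem_of_not_mem hy hc'h)
        have heven : π (Equiv.swap a b * Equiv.swap c c') g = g := by
          refine hfix_of g _ (hX g _ (fun y hy => ?_) ?_)
          · rw [Equiv.Perm.mul_apply,
              Equiv.swap_apply_of_ne_of_ne (ne_of_mem_of_not_mem hy hcg) (ne_of_mem_of_not_mem hy hc'g),
              Equiv.swap_apply_of_ne_of_ne (ne_of_mem_of_not_mem hy haX) (ne_of_mem_of_not_mem hy hbX)]
          · rw [map_mul, Equiv.Perm.sign_swap hab, Equiv.Perm.sign_swap hcc', Int.units_mul_self]
        have hmem : (π (Equiv.swap a b * Equiv.swap c c')) h ∈ C.children g := by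
          have := (hπ (Equiv.swap a b * Equiv.swap c c')).children_apply g
          rw [heven] at this
          rw [this, Finset.mem_map]
          exact ⟨h, hh, rfl⟩
        rwa [hπmul, Equiv.Perm.mul_apply, hfixh] at hmem
      · -- multiplication gate: the same
        refine hR _ _ (by rw [(hπ _).label_apply, hl]; rfl) ?_
        refine Finset.eq_of_subset_of_card_le (fun k hk => ?_) (by rw [(hπ _).children_apply,
          Finset.card_map])
        rw [(hπ _).children_apply, Finset.mem_map] at hk
        obtain ⟨h, hh, rfl⟩ := hk
        obtain ⟨c, c', hcc', hcg, hch, hcD, hc'g, hc'h, hc'D⟩ :=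
          exists_two_outside hn (X g) (X h) {a, b} (hXcard g) (hXcard h) Finset.card_le_two
        have hfixh : π (Equiv.swap c c') h = h :=
          ih h hh _ fun y hy => Equiv.swap_apply_of_ne_of_ne (ne_of_mem_of_not_mem hy hch)
            (ne_of_mem_of_not_mem hy hc'h)
        have heven : π (Equiv.swap a b * Equiv.swap c c') g = g := by
          refine hfix_of g _ (hX g _ (fun y hy => ?_) ?_)
          · rw [Equiv.Perm.mul_apply,
              Equiv.swap_apply_of_ne_of_ne (ne_of_mem_of_not_mem hy hcg) (ne_of_mem_of_not_mem hy hc'g),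
              Equiv.swap_apply_of_ne_of_ne (ne_of_mem_of_not_mem hy haX) (ne_of_mem_of_not_mem hy hbX)]
          · rw [map_mul, Equiv.Perm.sign_swap hab, Equiv.Perm.sign_swap hcc', Int.units_mul_self]
        have hmem : (π (Equiv.swap a b * Equiv.swap c c')) h ∈ C.children g := by
          have := (hπ (Equiv.swap a b * Equiv.swap c c')).children_apply g
          rw [heven] at this
          rw [this, Finset.mem_map]
          exact ⟨h, hh, rfl⟩
        rwa [hπmul, Equiv.Perm.mul_apply, hfixh] at hmem
    -- Step 2: an odd permutation fixing `X g` is a transposition outside `X g` times an even one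
    intro ρ hρ
    rcases Int.units_eq_one_or (Equiv.Perm.sign ρ) with hsign | hsign
    · exact hfix_of g ρ (hX g ρ hρ hsign)
    · obtain ⟨a, b, hab, haX, -, -, hbX, -, -⟩ :=
        exists_two_outside hn (X g) ∅ ∅ (hXcard g) (by simp) (by simp)
      have heven : π (Equiv.swap a b * ρ) g = g := by
        refine hfix_of g _ (hX g _ (fun y hy => ?_) ?_)
        · rw [Equiv.Perm.mul_apply, hρ y hy,
            Equiv.swap_apply_of_ne_of_ne (ne_of_mem_of_not_mem hy haX) (ne_of_mem_of_not_mem hy hbX)]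
        · rw [map_mul, Equiv.Perm.sign_swap hab, hsign, Int.units_mul_self]
      have : ρ = Equiv.swap a b * (Equiv.swap a b * ρ) := by
        rw [← mul_assoc, Equiv.swap_mul_self, one_mul]
      rw [this, hπmul, Equiv.Perm.mul_apply, heven, htrans a b hab haX hbX]

/-- **Values of a reduced circuit with even supports have supports.** [cite: DawarWilsenach2021, §4] -/
theorem support_eval_reduced {n : ℕ} {K : Type u} [CommSemiring K] {Y : Type*} {G : Type w}
    [MulAction (Equiv.Perm (Fin n)) Y] (C : LabelledArithCircuit K (Fin n × Fin n) Y G)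
    (hR : C.IsReduced) (hC : C.IsSymmetric (Equiv.Perm (Fin n))) {s : ℕ} (hn : 2 * s + 4 ≤ n)
    (X : G → Finset (Fin n)) (hXcard : ∀ g, (X g).card ≤ s)
    (hX : ∀ g (ρ : Equiv.Perm (Fin n)), (∀ x ∈ X g, ρ x = x) → Equiv.Perm.sign ρ = 1 →
      ∃ π : Equiv.Perm G, C.IsAutomorphismExtending ρ π ∧ π g = g)
    (g : G) (ρ : Equiv.Perm (Fin n)) (hρ : ∀ x ∈ X g, ρ x = x) :
    MvPolynomial.rename (fun x : Fin n × Fin n => ρ • x) (C.eval g) = C.eval g := by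
  obtain ⟨π, hπ, hπg⟩ := support_of_evenSupport_reduced C hR hC hn X hXcard hX g ρ hρ
  rw [← hπ.eval_apply g, hπg]

/-! ### Reduced circuits from value derivations -/

/-- **The value-orbit symmetrisation theorem, with reducedness recorded.**  As
`ValueDerivation.exists_symmetric_of_valueDerivation` (crux 18293's K3 engine), the circuit being the
reduced term circuit (`TermCircuit.circuit_isReduced`). [folklore] -/
theorem exists_reduced_symmetric_of_valueDerivation {K : Type u} {X : Type v} [Field K] [CharZero K]
    [Fintype X] (𝒟 : ValueDerivation K X) {Γ : Type w} [Group Γ] [Fintype Γ] [MulAction Γ X]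
    {f : MvPolynomial X K} (hf : f ∈ 𝒟.S) {B : ℕ} (hB : 1 ≤ B)
    (hfix : ∀ δ : Γ, ren δ f = f) (hXo : ∀ x : X, (Set.range fun δ : Γ => δ • x).ncard ≤ B)
    (hS : ∀ p ∈ 𝒟.S, (Set.range fun δ : Γ => ren δ p).ncard ≤ B) :
    ∃ (G : Type (max u v)) (_ : Fintype G) (C : LabelledArithCircuit K X Unit G),
      C.IsReduced ∧ C.IsSymmetric Γ ∧ C.eval (C.output ()) = f ∧ C.orbitSize Γ ≤ B * B := by
  have hroot : ∀ δ : Γ, act δ (𝒟.univ Γ hf).root = (𝒟.univ Γ hf).root := fun δ => by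
    change act δ (𝒟.tm Γ f) = 𝒟.tm Γ f
    rw [𝒟.act_tm δ (𝒟.mem_U_of_mem_S hf), hfix]
  have hstab := 𝒟.univ_stable (Γ := Γ) hf
  refine ⟨TermCircuit.Gate (𝒟.univ Γ hf), inferInstance, TermCircuit.circuit (𝒟.univ Γ hf),
    TermCircuit.circuit_isReduced _, TermCircuit.circuit_isSymmetric _ hstab hroot,
    (TermCircuit.eval_output _).trans (𝒟.val_tm (𝒟.mem_U_of_mem_S hf)),
    (TermCircuit.circuit_isReduced _).orbitSize_le (TermCircuit.perm _ hstab)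
      (TermCircuit.perm_isAutomorphismExtending _ hstab hroot) ?_⟩
  exact TermCircuit.ncard_range_perm_le _ hstab (B * B) (hB.trans (Nat.le_mul_of_pos_right B hB))
    (fun x => (hXo x).trans (Nat.le_mul_of_pos_right B hB))
    (fun t ht => 𝒟.ncard_orbit_term_le hf hB hXo hS ht)

/-- **Every square-symmetric circuit of quasi-polynomial orbit size can be replaced by a REDUCED one** (over
`ℂ`, one output), at the cost `c ↦ c + 3` in the exponent: circuit ⇒ value derivation
(`SymmetricValues.exists_valueDerivation_of_symmetric`) ⇒ reduced term circuit. [folklore] -/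
theorem exists_reduced_of_qpOrbit {n c : ℕ} {G : Type} [Fintype G]
    (C : LabelledArithCircuit ℂ (Fin n × Fin n) Unit G) (hC : C.IsSymmetric (Equiv.Perm (Fin n)))
    (horb : C.orbitSize (Equiv.Perm (Fin n)) ≤ 2 ^ ((Nat.log 2 n + c) ^ c)) :
    ∃ (G' : Type) (_ : Fintype G') (C' : LabelledArithCircuit ℂ (Fin n × Fin n) Unit G'),
      C'.IsReduced ∧ C'.IsSymmetric (Equiv.Perm (Fin n)) ∧ C'.eval (C'.output ()) = C.eval (C.output ()) ∧
        C'.orbitSize (Equiv.Perm (Fin n)) ≤ 2 ^ ((Nat.log 2 n + (c + 3)) ^ (c + 3)) := by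
  obtain ⟨𝒟, hf, hS⟩ := SymmetricValues.exists_valueDerivation_of_symmetric C hC
  have hfix : ∀ σ : Equiv.Perm (Fin n), ren σ (C.eval (C.output ())) = C.eval (C.output ()) :=
    fun σ => hC.rename_eval_output_unit σ
  set L := Nat.log 2 n with hL
  set B := 2 ^ ((L + c) ^ c + 2 * L + 2) with hB
  have hB1 : 1 ≤ B := Nat.one_le_two_pow
  have hXo : ∀ x : Fin n × Fin n, (Set.range fun σ : Equiv.Perm (Fin n) => σ • x).ncard ≤ B := fun x =>
    (ValueOrbit.ncard_orbit_var_le n x).trans ((ValueOrbit.sq_le_pow_log n).trans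
      (Nat.pow_le_pow_right (by norm_num) (by omega)))
  have hS' : ∀ q ∈ 𝒟.S, (Set.range fun σ : Equiv.Perm (Fin n) => ren σ q).ncard ≤ B := fun q hq =>
    ((hS q hq).trans horb).trans (Nat.pow_le_pow_right (by norm_num) (by omega))
  obtain ⟨G', inst, C', hR, hC', hev, horb'⟩ :=
    exists_reduced_symmetric_of_valueDerivation 𝒟 hf hB1 hfix hXo hS'
  refine ⟨G', inst, C', hR, hC', hev, horb'.trans ?_⟩
  rw [hB, ← pow_add, ← two_mul]
  exact Nat.pow_le_pow_right (by norm_num) (ValueOrbit.exp_arith L c)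

end OrbitSupport

end Summit.ValiantsHypothesis.ValiantsHypothesis.Theorems

end
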